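import Summits.CriticalPhenomena.PercolationContinuityZ3.Theorems.PercNearOneGluingNoHeavyQuantLightTwoBlobFlow
import Summits.CriticalPhenomena.PercolationContinuityZ3.Theorems.PercNearOneGluingNoHeavyQuantLawDecUsageMongeRates
import Summits.CriticalPhenomena.PercolationContinuityZ3.Theorems.PercNearOneGluingNoHeavyQuantFlowUncross
import HarnessLib

/-!
# QUANT lane R8, T-DEC: towards census-2 g55's `LawDec.SliceLawSW` (the last open input of `SliceSingleLayer`) — part 1: moving absorber mass to a
# higher mid preserves the flow form, and the FLOW of the transferred four-position law (the case `h′ = h`) with its numerical facts as hypotheses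

builds on p205010 (kernel theorem, internal audit signed; external expert review pending)

Support file (`--supports stmt-CriticalPhenomena-4575`), QUANT lane typer seat prim-quant-stmt (gen 24), rung R8 of
`run/shared/lean/prim/quant/LADDER.md`.  Theorems only, standard axioms, no sorries.  Continues `…QuantBandTwoBlobFlow/…DEC` (this seat: the band
piece) and serves census-2 g55's `…QuantSliceSingleLayerLaws` (`LawDec.SliceLawSW`: for a low `l`, a window absorber `h` and a window position
`h′ ≥ h`, SOME transfer `t` makes the law `(1−γ)[(1−g)δ_l + gδ_{l+a}] + γ(1−g)δ_h + t(1−g)δ_{h′} + (γg − t(1−g))δ_{h+a}` DEC(j′) at `T + ag`).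

THE PLAN (memo SINGLE-LAYER-G55 §3b/§3c + this seat's exact explorer quant/prim-quant-stmt-g24/explore/sw_explore.py, sw_merged.py, sw_cells.py):
(i) heavy pairs `γ ≥ x`: `t = 0` (`slice_heavyPair_decAtT`); (ii) light pairs with `h` band-like at `T′`: `t = 0`, the band piece (`bandTwoBlobDEC_holds`);
(iii) light pairs with `h` a true mid at `T′` and `h′ = h`: the transfer problem `∃ t` is EQUIVALENT to one transportation problem in which the giant and
the transferred capacity form a single absorber charged `min(x/(1−x), usage(p,h))` per unit of the low `p` (checked exactly against the corner run with a
free `t`, 500/500) — its cells are certified in parts 2–3; (iv) `h′ > h` follows from `h′ = h` with the SAME `t` by the first theorem below, since a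
higher window position is a cheaper mid for every low that can use `h` (`usage_anti_mid`, lead g21).

* **`LawDec.FlowAtT.shift_absorber_up`** — for absorber positions `h₁ < h₂ ≤ min(j′, M)` (`T ≤ 2h₁`) and `0 ≤ δ ≤ μ h₁` (`μ ≥ 0`):
  `FlowAtT x T j′ M μ → FlowAtT x T j′ M (μ − δ·e_{h₁} + δ·e_{h₂})` (move the fraction `δ/μ h₁` of every flow into `h₁` over to `h₂`).
* **`LawDec.swLawAt_decAtT_of_flow`** — the four-position law `(1−γ)(1−g)δ_l + (1−γ)gδ_{l+a} + (γ+t)(1−g)δ_h + (γg − t(1−g))δ_{h+a}` (= `swLaw γ g t l h h a`)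
  at a straddling layer (`l + a ≤ j″`, `h ≤ j″ < h + a`, `h ≤ M`), target `T′` with `2l < T′ ≤ 2h`: flows `l+a ↦ h` (`F₁`, only if `l + a` is low,
  `2(l+a) < T′`), `l ↦ h` (`F₂`, only if `T′ < l + h`), `l ↦ l+a` (`F₃`, only if `l + a` is an absorber compatible with `l`), the rest into the giant `h + a`;
  mid and giant inequalities as hypotheses ⟹ `DECAtT x T′ j″ (M + a)` of the law (the positions `l + a` and `h` may coincide).

[this work]; flow normal form `…QuantLawDecFlows` (typer g22), `usage_anti_mid` (`…QuantLawDecUsageMongeRates`, lead g21).  Nothing here is cited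
as a published result.  The gluing rows served [cite: KozmaNitzan2024, Conjecture 3 (p. 15)]; product measure [cite: Grimmett1999, §1.3 p. 10].
-/

noncomputable section

namespace Summit.CriticalPhenomena.PercolationContinuityZ3.Theorems

namespace Quant

open Finset

namespace LawDec

/-! ### Moving absorber mass to a higher mid -/

/-- **MOVING ABSORBER MASS UP TO A HIGHER MID PRESERVES THE FLOW FORM.**  `0 < x < 1`, `μ ≥ 0`, absorbers `h₁ < h₂` with `T ≤ 2h₁`,
`h₂ ≤ j′`, `h₂ ≤ M`, and `0 ≤ δ ≤ μ h₁`: `FlowAtT x T j′ M μ → FlowAtT x T j′ M (μ − δ·e_{h₁} + δ·e_{h₂})`.  Proof: send the fraction `θ = δ/μ h₁`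
of every flow into `h₁` to `h₂` instead — rows are unchanged, the load of `h₁` drops to `(1−θ)·load ≤ μ h₁ − δ`, the load of `h₂` grows by at most
`θ·load(h₁) ≤ δ` because `usage(l, h₂) ≤ usage(l, h₁)` for every low compatible with `h₁` (`usage_anti_mid`). [this work] -/
theorem FlowAtT.shift_absorber_up {x T : ℝ} {j' M : ℕ} {μ : ℕ → ℝ} (hF : FlowAtT x T j' M μ) (hx0 : 0 < x) (hx1 : x < 1)
    (hμ : ∀ k, 0 ≤ μ k) (h₁ h₂ : ℕ) (hh : h₁ < h₂) (hh2j : h₂ ≤ j') (hh2M : h₂ ≤ M) (habs : T ≤ 2 * (h₁ : ℝ))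
    (δ : ℝ) (hδ0 : 0 ≤ δ) (hδ : δ ≤ μ h₁) :
    FlowAtT x T j' M (fun k => μ k - δ * (if k = h₁ then (1:ℝ) else 0) + δ * (if k = h₂ then (1:ℝ) else 0)) := by
  classical
  obtain ⟨f, hf0, hsupp, hrow, hcol⟩ := hF
  have hne : h₁ ≠ h₂ := by omega
  have hh1j : h₁ ≤ j' := by omega
  have hh1M : h₁ ≤ M := by omega
  -- the moved fraction
  set θ : ℝ := if μ h₁ = 0 then 0 else δ / μ h₁ with hθ
  have hθ0 : 0 ≤ θ := by
    rw [hθ]; split_ifs with hz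
    · exact le_rfl
    · exact div_nonneg hδ0 (hμ h₁)
  have hθ1 : θ ≤ 1 := by
    rw [hθ]; split_ifs with hz
    · exact zero_le_one
    · exact (div_le_one (lt_of_le_of_ne (hμ h₁) (Ne.symm hz))).2 hδ
  have hθμ : θ * μ h₁ = δ := by
    rw [hθ]; split_ifs with hz
    · rw [zero_mul]; rw [hz] at hδ; linarith
    · field_simp
  refine ⟨fun l h => f l h - θ * f l h₁ * (if h = h₁ then (1:ℝ) else 0) + θ * f l h₁ * (if h = h₂ then (1:ℝ) else 0), ?_, ?_, ?_, ?_⟩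
  · -- nonnegativity
    intro l h
    dsimp only
    by_cases hh1 : h = h₁
    · rw [if_pos hh1, if_neg (by omega : h ≠ h₂), hh1]
      nlinarith [hf0 l h₁, mul_le_mul_of_nonneg_right hθ1 (hf0 l h₁)]
    · rw [if_neg hh1]
      by_cases hh2' : h = h₂
      · rw [if_pos hh2']; nlinarith [hf0 l h, mul_nonneg hθ0 (hf0 l h₁)]
      · rw [if_neg hh2']; linarith [hf0 l h]
  · -- support: the only new pairs are `(l, h₂)` for lows `l` with `f l h₁ > 0`, compatible since `h₂ > h₁`
    intro l h hpos
    dsimp only at hpos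
    by_cases hh1 : h = h₁
    · rw [if_pos hh1, if_neg (by omega : h ≠ h₂)] at hpos
      have : 0 < f l h := by nlinarith [mul_nonneg hθ0 (hf0 l h₁), hh1 ▸ hf0 l h]
      exact hsupp l h this
    · rw [if_neg hh1] at hpos
      by_cases hh2' : h = h₂
      · rw [if_pos hh2'] at hpos
        by_cases hp : 0 < f l h
        · exact hsupp l h hp
        · have hz : f l h = 0 := le_antisymm (not_lt.1 hp) (hf0 l h)
          rw [hz] at hpos
          have hp1 : 0 < f l h₁ := by
            by_contra hn
            have : f l h₁ = 0 := le_antisymm (not_lt.1 hn) (hf0 l h₁)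
            rw [this] at hpos; simp at hpos
          obtain ⟨hl, hlow, -, hc⟩ := hsupp l h₁ hp1
          refine ⟨hl, hlow, by omega, Or.inr ?_⟩
          rcases hc with hc | hc
          · omega
          · rw [hh2']
            have : (h₁ : ℝ) < h₂ := by exact_mod_cast hh
            linarith
      · rw [if_neg hh2'] at hpos
        have : 0 < f l h := by linarith
        exact hsupp l h this
  · -- rows are unchanged
    intro l hl hlow
    dsimp only
    simp only [Finset.sum_add_distrib, Finset.sum_sub_distrib]
    rw [BlobDec2.sum_range_const_indicator M h₁ hh1M, BlobDec2.sum_range_const_indicator M h₂ hh2M, hrow l hl hlow]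
    have hh' : (h₁ : ℝ) < h₂ := by exact_mod_cast hh
    have hlh : l ≠ h₁ := by
      intro he
      have : (l : ℝ) = h₁ := by exact_mod_cast he
      linarith
    have hlh2 : l ≠ h₂ := by
      intro he
      have : (l : ℝ) = h₂ := by exact_mod_cast he
      linarith
    rw [if_neg hlh, if_neg hlh2]
    ring
  · -- columns
    intro h hhM hself
    dsimp only
    have e : ∀ l, usage x T j' l h * (f l h - θ * f l h₁ * (if h = h₁ then (1:ℝ) else 0) + θ * f l h₁ * (if h = h₂ then (1:ℝ) else 0))
        = usage x T j' l h * f l h - (if h = h₁ then (1:ℝ) else 0) * (θ * (usage x T j' l h * f l h₁))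
          + (if h = h₂ then (1:ℝ) else 0) * (θ * (usage x T j' l h * f l h₁)) := by
      intro l; ring
    simp only [e, Finset.sum_add_distrib, Finset.sum_sub_distrib, ← Finset.mul_sum]
    by_cases hh1 : h = h₁
    · -- the donor: `(1 − θ)·load ≤ μ h₁ − δ`
      rw [if_pos hh1, if_neg (by omega : h ≠ h₂), hh1]
      have hL := hcol h₁ hh1M (Or.inr habs)
      have hL0 : 0 ≤ ∑ l ∈ Finset.range (j' + 1), usage x T j' l h₁ * f l h₁ := by
        refine Finset.sum_nonneg (fun l _ => ?_)
        rcases (hf0 l h₁).eq_or_lt with hz | hp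
        · rw [← hz, mul_zero]
        · obtain ⟨-, hlow, -, hc⟩ := hsupp l h₁ hp
          have hlh : l < h₁ := by
            rcases hc with hc | hc
            · omega
            · have : (l : ℝ) < h₁ := by linarith
              exact_mod_cast this
          exact (mul_pos (usage_pos_of_compat x T j' l h₁ hx0 hx1 hlow hlh hc) hp).le
      nlinarith [mul_le_mul_of_nonneg_left hL hθ0]
    · rw [if_neg hh1]
      by_cases hh2' : h = h₂
      · -- the receiver: the moved load is at most `θ·load(h₁) ≤ δ`
        rw [if_pos hh2', hh2']
        have hh' : (h₁ : ℝ) < h₂ := by exact_mod_cast hh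
        have hL2 := hcol h₂ hh2M (Or.inr (by linarith))
        have hcmp : ∑ l ∈ Finset.range (j' + 1), usage x T j' l h₂ * f l h₁
            ≤ ∑ l ∈ Finset.range (j' + 1), usage x T j' l h₁ * f l h₁ := by
          refine Finset.sum_le_sum (fun l _ => ?_)
          rcases (hf0 l h₁).eq_or_lt with hz | hp
          · rw [← hz, mul_zero, mul_zero]
          · obtain ⟨-, hlow, -, hc⟩ := hsupp l h₁ hp
            have hc' : T < (l : ℝ) + h₁ := by
              rcases hc with hc | hc
              · omega
              · exact hc
            exact mul_le_mul_of_nonneg_right (usage_anti_mid x T j' l h₁ h₂ hx0 hx1 hh hh2j hlow hc') hp.le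
        have hL1 := hcol h₁ hh1M (Or.inr habs)
        nlinarith [mul_le_mul_of_nonneg_left (hcmp.trans hL1) hθ0]
      · rw [if_neg hh2']
        have h0 := hcol h hhM hself
        linarith

/-! ### The flow of the transferred four-position law (`h′ = h`) -/

/-- **DEC OF THE TRANSFERRED LAW FROM ITS FLOW** (`h′ = h`).  Law `ν = (1−γ)(1−g)δ_l + (1−γ)gδ_{l+a} + (γ+t)(1−g)δ_h + (γg − t(1−g))δ_{h+a}`, floor
`0 < x < 1`, `γ ∈ [0,1]`, `g ∈ [0,1]`, `0 ≤ t(1−g) ≤ γg`, positions `l < h ≤ j″ < h + a`, `l + a ≤ j″`, `h ≤ M`, target `T′` with `2l < T′ ≤ 2h`.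
Flows: `l+a ↦ h` (amount `F₁`, positive only if `2(l+a) < T′` and `T′ < l + a + h`), `l ↦ h` (`F₂`, positive only if `T′ < l + h`), `l ↦ l+a`
(`F₃`, positive only if `T′ ≤ 2(l+a)` and `T′ < 2l + a`), `l ↦ h+a` (`(1−γ)(1−g) − F₂ − F₃ ≥ 0`), `l+a ↦ h+a` (`(1−γ)g − F₁` when `l + a` is low).
If the position `h` is not overloaded (`usage(l+a,h)·F₁ + usage(l,h)·F₂ ≤ (γ+t)(1−g)`), nor the position `l + a` (`usage(l,l+a)·F₃ ≤ (1−γ)g`), nor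
the giant (`x/(1−x)·([2(l+a) < T′]·((1−γ)g − F₁) + (1−γ)(1−g) − F₂ − F₃) ≤ γg − t(1−g)`), then `DECAtT x T′ j″ (M + a) ν`. [this work] -/
theorem swLawAt_decAtT_of_flow (x γ g T' t F₁ F₂ F₃ : ℝ) (l h a j'' M : ℕ) (hx0 : 0 < x) (hx1 : x < 1) (hγ0 : 0 ≤ γ) (hγ1 : γ ≤ 1)
    (hg0 : 0 ≤ g) (hg1 : g ≤ 1) (ht0 : 0 ≤ t) (ht : t * (1 - g) ≤ γ * g)
    (hlh : l < h) (hla : l + a ≤ j'') (hhj : h ≤ j'') (hj : j'' < h + a) (hhM : h ≤ M)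
    (hlow : 2 * (l : ℝ) < T') (hhabs : T' ≤ 2 * (h : ℝ))
    (hF1 : 0 ≤ F₁) (hF1' : F₁ ≤ (1 - γ) * g) (hF1c : 0 < F₁ → 2 * ((l : ℝ) + a) < T' ∧ T' < (l : ℝ) + a + h)
    (hF2 : 0 ≤ F₂) (hF2c : 0 < F₂ → T' < (l : ℝ) + h)
    (hF3 : 0 ≤ F₃) (hF3c : 0 < F₃ → T' ≤ 2 * ((l : ℝ) + a) ∧ T' < 2 * (l : ℝ) + a)
    (hR0 : F₂ + F₃ ≤ (1 - γ) * (1 - g))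
    (hmid : usage x T' j'' (l + a) h * F₁ + usage x T' j'' l h * F₂ ≤ (γ + t) * (1 - g))
    (hmid1 : usage x T' j'' l (l + a) * F₃ ≤ (1 - γ) * g)
    (htop : x / (1 - x) * ((if 2 * ((l : ℝ) + a) < T' then (1 - γ) * g - F₁ else 0) + ((1 - γ) * (1 - g) - F₂ - F₃)) ≤ γ * g - t * (1 - g)) :
    DECAtT x T' j'' (M + a) (fun p => (1 - γ) * (1 - g) * (if p = l then (1:ℝ) else 0) + (1 - γ) * g * (if p = l + a then (1:ℝ) else 0)
      + (γ + t) * (1 - g) * (if p = h then (1:ℝ) else 0) + (γ * g - t * (1 - g)) * (if p = h + a then (1:ℝ) else 0)) := by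
  classical
  have ha0 : 1 ≤ a := by omega
  have hm0 : 0 ≤ (1 - γ) * (1 - g) := mul_nonneg (by linarith) (by linarith)
  have hm1 : 0 ≤ (1 - γ) * g := mul_nonneg (by linarith) hg0
  have hmh : 0 ≤ (γ + t) * (1 - g) := mul_nonneg (by linarith) (by linarith)
  have hmG : 0 ≤ γ * g - t * (1 - g) := by linarith
  -- distinctness of the positions (only `l + a = h` may happen)
  have hl_la : l ≠ l + a := by omega
  have hl_h : l ≠ h := by omega
  have hl_ha : l ≠ h + a := by omega
  have hla_ha : l + a ≠ h + a := by omega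
  have hh_ha : h ≠ h + a := by omega
  -- the leftovers
  set R₀ : ℝ := (1 - γ) * (1 - g) - F₂ - F₃ with hR₀
  set R₁ : ℝ := (if 2 * ((l : ℝ) + a) < T' then (1 - γ) * g - F₁ else 0) with hR₁
  have hR00 : 0 ≤ R₀ := by rw [hR₀]; linarith
  have hR10 : 0 ≤ R₁ := by rw [hR₁]; split_ifs <;> linarith
  -- `F₁` vanishes unless `l + a` is low
  have hF1z : ¬ (2 * ((l : ℝ) + a) < T') → F₁ = 0 := by
    intro hn; by_contra hne; exact hn (hF1c (lt_of_le_of_ne hF1 (Ne.symm hne))).1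
  set f : ℕ → ℕ → ℝ := fun p q =>
    F₁ * (if p = l + a then (1:ℝ) else 0) * (if q = h then (1:ℝ) else 0)
      + R₁ * (if p = l + a then (1:ℝ) else 0) * (if q = h + a then (1:ℝ) else 0)
      + F₂ * (if p = l then (1:ℝ) else 0) * (if q = h then (1:ℝ) else 0)
      + F₃ * (if p = l then (1:ℝ) else 0) * (if q = l + a then (1:ℝ) else 0)
      + R₀ * (if p = l then (1:ℝ) else 0) * (if q = h + a then (1:ℝ) else 0) with hf
  have ind_nn : ∀ (P : Prop) [Decidable P], (0:ℝ) ≤ (if P then (1:ℝ) else 0) := fun P _ => by split_ifs <;> norm_num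
  have ind_le : ∀ (P : Prop) [Decidable P], (if P then (1:ℝ) else 0) ≤ 1 := fun P _ => by split_ifs <;> norm_num
  -- mass and support of the law
  have hvan : ∀ p, M + a < p → (1 - γ) * (1 - g) * (if p = l then (1:ℝ) else 0) + (1 - γ) * g * (if p = l + a then (1:ℝ) else 0)
      + (γ + t) * (1 - g) * (if p = h then (1:ℝ) else 0) + (γ * g - t * (1 - g)) * (if p = h + a then (1:ℝ) else 0) = 0 := by
    intro p hp
    rw [if_neg (by omega : p ≠ l), if_neg (by omega : p ≠ l + a), if_neg (by omega : p ≠ h), if_neg (by omega : p ≠ h + a)]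
    ring
  have hmass : ∑ p ∈ Finset.range (M + a + 1), ((1 - γ) * (1 - g) * (if p = l then (1:ℝ) else 0)
      + (1 - γ) * g * (if p = l + a then (1:ℝ) else 0) + (γ + t) * (1 - g) * (if p = h then (1:ℝ) else 0)
      + (γ * g - t * (1 - g)) * (if p = h + a then (1:ℝ) else 0)) = 1 := by
    simp only [Finset.sum_add_distrib]
    rw [BlobDec2.sum_range_const_indicator _ l (by omega), BlobDec2.sum_range_const_indicator _ (l + a) (by omega),
      BlobDec2.sum_range_const_indicator _ h (by omega), BlobDec2.sum_range_const_indicator _ (h + a) (by omega)]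
    ring
  refine decAtT_of_flowAtT x T' j'' (M + a) _ hx0 hx1 hvan hmass ⟨f, ?_, ?_, ?_, ?_⟩
  · -- nonnegativity
    intro p q
    simp only [hf]
    have i1 := ind_nn (p = l + a); have i2 := ind_nn (q = h); have i3 := ind_nn (q = h + a); have i4 := ind_nn (p = l)
    have i5 := ind_nn (q = l + a)
    have := mul_nonneg (mul_nonneg hF1 i1) i2
    have := mul_nonneg (mul_nonneg hR10 i1) i3
    have := mul_nonneg (mul_nonneg hF2 i4) i2
    have := mul_nonneg (mul_nonneg hF3 i4) i5
    have := mul_nonneg (mul_nonneg hR00 i4) i3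
    linarith
  · -- support
    intro p q hpos
    simp only [hf] at hpos
    by_cases hp : p = l + a
    · rw [if_pos hp, if_neg (by omega : p ≠ l)] at hpos
      simp only [mul_one, mul_zero, zero_mul, add_zero] at hpos
      -- `l + a` ships only when it is low
      have hlowa : 2 * ((l : ℝ) + a) < T' := by
        by_contra hn
        rw [hF1z hn, hR₁, if_neg hn] at hpos
        simp at hpos
      have hp' : 2 * (p : ℝ) < T' := by rw [hp]; push_cast; exact hlowa
      by_cases hq : q = h
      · rw [if_pos hq, if_neg (by omega : q ≠ h + a), mul_one, mul_zero, add_zero] at hpos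
        refine ⟨by omega, hp', by omega, Or.inr ?_⟩
        rw [hp, hq]; push_cast; linarith [(hF1c hpos).2]
      · rw [if_neg hq, mul_zero, zero_add] at hpos
        by_cases hq' : q = h + a
        · exact ⟨by omega, hp', by omega, Or.inl (by omega)⟩
        · rw [if_neg hq', mul_zero] at hpos; exact absurd hpos (lt_irrefl 0)
    · rw [if_neg hp] at hpos
      by_cases hp0 : p = l
      · rw [if_pos hp0] at hpos
        simp only [mul_one, mul_zero, zero_mul, zero_add] at hpos
        have hp' : 2 * (p : ℝ) < T' := by rw [hp0]; exact hlow
        by_cases hq : q = h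
        · -- `(l, h)`, possibly together with `(l, l+a)` when `l + a = h`
          have hsum : 0 < F₂ + F₃ * (if q = l + a then (1:ℝ) else 0) := by
            rw [if_pos hq, if_neg (by omega : q ≠ h + a)] at hpos; linarith
          refine ⟨by omega, hp', by omega, Or.inr ?_⟩
          rw [hp0, hq]
          by_cases hF2p : 0 < F₂
          · exact hF2c hF2p
          · have hF2z : F₂ = 0 := le_antisymm (not_lt.1 hF2p) hF2
            rw [hF2z, zero_add] at hsum
            have hqla : q = l + a := by
              by_contra hn; rw [if_neg hn, mul_zero] at hsum; exact lt_irrefl _ hsum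
            rw [if_pos hqla, mul_one] at hsum
            have := (hF3c hsum).2
            have hhla : (h : ℝ) = (l : ℝ) + a := by rw [← hq, hqla]; push_cast; ring
            linarith
        · rw [if_neg hq, mul_zero, zero_add] at hpos
          by_cases hqla : q = l + a
          · rw [if_pos hqla, if_neg (by omega : q ≠ h + a), mul_one, mul_zero, add_zero] at hpos
            refine ⟨by omega, hp', by omega, Or.inr ?_⟩
            rw [hp0, hqla]; push_cast; linarith [(hF3c hpos).2]
          · rw [if_neg hqla, mul_zero, zero_add] at hpos
            by_cases hq' : q = h + a
            · exact ⟨by omega, hp', by omega, Or.inl (by omega)⟩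
            · rw [if_neg hq', mul_zero] at hpos; exact absurd hpos (lt_irrefl 0)
      · rw [if_neg hp0] at hpos
        simp only [mul_zero, zero_mul, add_zero] at hpos
        exact absurd hpos (lt_irrefl 0)
  · -- every low is shipped exactly
    intro p hpj hplow
    have hsum : ∑ q ∈ Finset.range (M + a + 1), f p q
        = F₁ * (if p = l + a then (1:ℝ) else 0) + R₁ * (if p = l + a then (1:ℝ) else 0)
          + F₂ * (if p = l then (1:ℝ) else 0) + F₃ * (if p = l then (1:ℝ) else 0) + R₀ * (if p = l then (1:ℝ) else 0) := by
      simp only [hf, Finset.sum_add_distrib]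
      rw [BlobDec2.sum_range_const_indicator _ h (by omega), BlobDec2.sum_range_const_indicator _ (h + a) (by omega),
        BlobDec2.sum_range_const_indicator _ h (by omega), BlobDec2.sum_range_const_indicator _ (l + a) (by omega),
        BlobDec2.sum_range_const_indicator _ (h + a) (by omega)]
    rw [hsum]
    dsimp only
    have hph : p ≠ h := by rintro rfl; linarith
    have hpha : p ≠ h + a := by omega
    by_cases hp0 : p = l
    · rw [if_neg (by omega : p ≠ l + a), if_pos hp0, if_neg hph, if_neg hpha, hR₀]; ring
    · by_cases hp : p = l + a
      · have hlowa : 2 * ((l : ℝ) + a) < T' := by rw [hp] at hplow; push_cast at hplow; exact hplow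
        rw [if_pos hp, if_neg hp0, if_neg hph, if_neg hpha, hR₁, if_pos hlowa]; ring
      · rw [if_neg hp, if_neg hp0, if_neg hph, if_neg hpha]; ring
  · -- no absorber is overloaded
    intro q hqM hself
    have hsum : ∑ p ∈ Finset.range (j'' + 1), usage x T' j'' p q * f p q
        = usage x T' j'' (l + a) q * F₁ * (if q = h then (1:ℝ) else 0)
          + usage x T' j'' (l + a) q * R₁ * (if q = h + a then (1:ℝ) else 0)
          + usage x T' j'' l q * F₂ * (if q = h then (1:ℝ) else 0)
          + usage x T' j'' l q * F₃ * (if q = l + a then (1:ℝ) else 0)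
          + usage x T' j'' l q * R₀ * (if q = h + a then (1:ℝ) else 0) := by
      have e : ∀ p, usage x T' j'' p q * f p q
          = (usage x T' j'' (l + a) q * F₁ * (if q = h then (1:ℝ) else 0)) * (if p = l + a then (1:ℝ) else 0)
            + (usage x T' j'' (l + a) q * R₁ * (if q = h + a then (1:ℝ) else 0)) * (if p = l + a then (1:ℝ) else 0)
            + (usage x T' j'' l q * F₂ * (if q = h then (1:ℝ) else 0)) * (if p = l then (1:ℝ) else 0)
            + (usage x T' j'' l q * F₃ * (if q = l + a then (1:ℝ) else 0)) * (if p = l then (1:ℝ) else 0)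
            + (usage x T' j'' l q * R₀ * (if q = h + a then (1:ℝ) else 0)) * (if p = l then (1:ℝ) else 0) := by
        intro p
        simp only [hf]
        by_cases hp : p = l + a
        · rw [if_pos hp, if_neg (by omega : p ≠ l), hp]; ring
        · by_cases hp0 : p = l
          · rw [if_neg hp, if_pos hp0, hp0]; ring
          · rw [if_neg hp, if_neg hp0]; ring
      simp only [e, Finset.sum_add_distrib]
      rw [BlobDec2.sum_range_const_indicator _ (l + a) hla, BlobDec2.sum_range_const_indicator _ (l + a) hla,
        BlobDec2.sum_range_const_indicator _ l (by omega), BlobDec2.sum_range_const_indicator _ l (by omega),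
        BlobDec2.sum_range_const_indicator _ l (by omega)]
    rw [hsum]
    dsimp only
    have hql : q ≠ l := by
      rintro rfl
      rcases hself with h1 | h1
      · omega
      · linarith
    by_cases hqh : q = h
    · -- the position `h` (together with `l + a` when they coincide)
      rw [if_pos hqh, if_neg (by omega : q ≠ h + a), if_neg hql]
      by_cases hqla : q = l + a
      · rw [if_pos hqla]
        simp only [mul_one, mul_zero, add_zero, zero_add]
        have e1 : usage x T' j'' (l + a) q * F₁ + usage x T' j'' l q * F₂ + usage x T' j'' l q * F₃
            = (usage x T' j'' (l + a) h * F₁ + usage x T' j'' l h * F₂) + usage x T' j'' l (l + a) * F₃ := by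
          rw [hqh]; nth_rewrite 3 [← hqh]; rw [hqla]
        rw [e1]
        linarith [hmid, hmid1]
      · rw [if_neg hqla]
        simp only [mul_one, mul_zero, add_zero, zero_add]
        rw [hqh]
        linarith [hmid]
    · rw [if_neg hqh]
      by_cases hqha : q = h + a
      · -- the giant `h + a`
        rw [if_pos hqha, if_neg hql, if_neg (by omega : q ≠ l + a)]
        simp only [mul_one, mul_zero, add_zero, zero_add]
        have hgq : j'' + 1 ≤ q := by omega
        rw [usage_giant_eq x T' j'' (l + a) q hgq, usage_giant_eq x T' j'' l q hgq]
        have : x / (1 - x) * R₁ + x / (1 - x) * R₀ ≤ γ * g - t * (1 - g) := by rw [← mul_add]; exact htop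
        linarith
      · rw [if_neg hqha]
        by_cases hqla : q = l + a
        · -- the position `l + a` (distinct from `h` here)
          rw [if_pos hqla, if_neg hql]
          simp only [mul_one, mul_zero, add_zero, zero_add]
          rw [hqla]
          linarith [hmid1]
        · -- any other position carries nothing
          rw [if_neg hqla, if_neg hql]
          simp only [mul_zero, add_zero]
          rfl

end LawDec

end Quant

end Summit.CriticalPhenomena.PercolationContinuityZ3.Theorems
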